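import Literature.MathematicalPhysics.KineticTheory.Sweep1EmpiricalProofs
import Literature.Analysis.FluidPDE.BBGKYMarginalsProofs
import Literature.Analysis.FluidPDE.BBGKYMarginalsCorrelationProofs
import Literature.Analysis.FluidPDE.HardSphereRegularGeometry
import Literature.MathematicalPhysics.KineticTheory.LanfordTensorisedHierarchy
import HarnessLib

/-!
# Hilbert's sixth problem, sweep 1: the canonical data of Lanford's theorem are admissible
# (GST 2013 Prop. 6.1.2 on `T^d`) — chaos of the conditioned data, uniformly and in mode A

Second companion of `Literature.MathematicalPhysics.KineticTheory.Sweep1` for the named fact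
`lanford_tendstoEmpirical` (**hilbert6.S08**), continuing `…Sweep1EmpiricalProofs`, whose final
reduction `lanford_tendstoEmpirical_of_canonicalChaos` leaves exactly Lanford's theorem in mode A
for the *canonical* ensemble on `T^d` to be proved. In the proof of that theorem
(Gallagher–Saint-Raymond–Texier 2013, Thm 8, for the conditioned data of §6.1) the only input
that is specific to the canonical ensemble is the *admissibility* of the conditioned data
(GST 2013 §6.1, Prop. 6.1.2 of the printed book = Prop. `init-cv1` of arXiv:1208.5753v3 Ch. 6
§1.3, with the ratio lemma `1 ≤ 𝒵_N⁻¹ 𝒵_{N-s} ≤ (1 - ε κ_d |f₀|_{L^∞L^1})^{-s}`, Lemma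
`lem:bd-f0HS` = Lemma 6.1.2): the marginals `f_{0,N}^{(s)}` of `𝒵_N⁻¹ 1_{D_ε^N} f₀^{⊗N}`
(`Literature.Analysis.FluidPDE.canonicalDensity`, `Literature.Analysis.FluidPDE.nthMarginal`)
obey uniform Lanford-class bounds ("first step") and converge to `f₀^{⊗s}` locally uniformly
off the diagonal in the scaling `N ε^{d-1} ≡ 1` ("second step"). This file PROVES it, on `T^d`,
for a general datum `0 ≤ f₀ ≤ C M_β` of mass one (theorems only; no definition, no named fact):

1. `nthMarginal_canonicalDensity_eq` — the exact formula of the second step, on a general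
   geometry: `f_{0,N}^{(s)}(Z_s) = 𝒵_N[f₀]⁻¹ · 1_{D_ε^s} f₀^{⊗s}(Z_s) · 𝒵_{N-s}[1_{S_ε(Z_s)} f₀]`,
   `S_ε(Z_s)` the one-particle states `ε`-separated from the tagged particles (printed:
   `f_{0,N}^{(s)} = 𝒵_N⁻¹ 1_{D_s} f₀^{⊗s} (𝒵_{N-s} - 𝒵^♭_{(s+1,N)})`), from the factorisation
   `Literature.Analysis.FluidPDE.indicator_hardSphereDomain_tensorPow_append`; hence the first
   step `f_{0,N}^{(s)} ≤ 𝒵_N⁻¹ 𝒵_{N-s} 1_{D_s} f₀^{⊗s}` (`nthMarginal_canonicalDensity_le_ratio`).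
2. `canonicalPartition_succ_le_of_mass_one`, `canonicalPartition_pow_mul_le_add`,
   `inv_mul_canonicalPartition_le_one_add` — the ratio lemma on `T^d` with the excluded mass
   `(2ε)^d C` per sphere (continuing `LanfordEmpirical.canonicalPartition_succ_ge` of the first
   companion): `𝒵_{k+1} ≤ 𝒵_k ≤ 1`, `(1 - n (2ε)^d C)^j 𝒵_m ≤ 𝒵_{m+j}`, and in the regime
   `(N-1)(2ε)^d C ≤ 1/2`, `1 ≤ 𝒵_N⁻¹ 𝒵_{N-s} ≤ 1 + 2^{s+1} (N-1)(2ε)^d C`.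
3. `abs_nthMarginal_canonicalDensity_sub_le` — **the two-sided estimate**: in that regime,
   `|f_{0,N}^{(s)} - 1_{D_ε^s} f₀^{⊗s}| ≤ (s+1) 2^{s+1} N (2ε)^d C · 1_{D_ε^s} f₀^{⊗s}`
   everywhere (the lower bound uses the first-order exclusion estimate
   `Literature.Analysis.FluidPDE.canonicalPartition_succ_sub_indicator_le` and the excluded
   volume `∫ 1_{S_εᶜ} f₀ ≤ s (2ε)^d C` on the torus), together with the uniform bound
   `f_{0,N}^{(s)} ≤ 2^s 1_{D_ε^s} f₀^{⊗s}` (`nthMarginal_canonicalDensity_le_two_pow_mul`).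
4. Along an exact Boltzmann–Grad sequence `N_k ε_k^{d-1} = 1`, `d ≥ 2`, the rate is
   `N_k (2ε_k)^d C = 2^d C ε_k → 0` (`excludedMass_eq_of_exact`), whence
   `tendsto_nthMarginal_canonicalDensity` (convergence at every configuration with distinct
   positions, GST's "locally uniformly in `Ω_s`") and `tendstoMarginals_canonicalDensity`
   (**mode A at the initial time**, `Literature.Analysis.FluidPDE.TendstoMarginals` for the
   time-independent families, GST 2013 Def. 6.2.1 via Lemma 6.2.2).

What this is for: in the assembly of hypothesis `H` of `lanford_tendstoEmpirical_of_canonicalChaos`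
from the Duhamel series of the two hierarchies (`LanfordTensorisedHierarchy`,
`LanfordModeAConvergence` and the BBGKY layers still to come), items 3–4 are the bounds and the
convergence of the initial data — the `n = 0`, `t = 0` input of the term-by-term comparison.

## References

* I. Gallagher, L. Saint-Raymond, B. Texier, *From Newton to Boltzmann: hard spheres and
  short-range potentials*, EMS ZLAM (2013); arXiv:1208.5753v3, Ch. 6 §1.2 (conditioning,
  (6.1.2)–(6.1.3), Lemma `lem:bd-f0HS`), §1.3 Prop. `init-cv1` (proof, first and second steps),
  §2.1 Def. `def:cv` and Lemma 2.2 (held: `lit read paper:arxiv-1208.5753`, chunks 32–35).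
  Bib key `GST2013`.
* T. Bodineau, I. Gallagher, L. Saint-Raymond, Invent. Math. 203 (2016), Prop. 3.2 and
  Appendix A (the same estimates for the Maxwellian on `T^d`, formalised in
  `…TaggedSphereLinearBoltzmann`).
-/

open MeasureTheory Set Filter Topology Function
open scoped ENNReal
open Literature.Analysis.FluidPDE Literature.Analysis.FunctionSpaces

namespace Literature.MathematicalPhysics.KineticTheory

noncomputable section

namespace LanfordEmpirical

/-! ## The exact formula for the marginals of the conditioned data (general geometry) -/

section General

variable {d : Type*} [Fintype d] {X : Type*} [MeasureSpace X]

/-- Reindexing a configuration along `Fin.cast` does not change the canonical density.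
[folklore] -/
theorem canonicalDensity_comp_cast_apply (G : Geometry d X) (ε : ℝ)
    (f₀ : X × EuclideanSpace ℝ d → ℝ) {k n : ℕ} (h : k = n) (z : Config k d X) :
    canonicalDensity G ε n f₀ (fun i => z (Fin.cast h.symm i)) = canonicalDensity G ε k f₀ z := by
  subst h
  simp only [Fin.cast_eq_self]

/-- The integrand of `nthMarginal n s` of the canonical density, after the index cast, is the
Gibbs-type weight of `s + k` spheres normalised by `𝒵_n`. [folklore] -/
theorem marginal_canonicalDensity_comp_cast (G : Geometry d X) (ε : ℝ)
    (f₀ : X × EuclideanSpace ℝ d → ℝ) {s k n : ℕ} (e : s + k = n) (Zs : Config s d X) :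
    marginal s k (fun z : Config (s + k) d X =>
        canonicalDensity G ε n f₀ fun i => z (Fin.cast e.symm i)) Zs =
      (canonicalPartition G ε n f₀)⁻¹ *
        marginal s k ((hardSphereDomain G (s + k) ε).indicator (tensorPow (s + k) f₀)) Zs := by
  rw [marginal, marginal, ← integral_const_mul]
  congr 1
  funext zm
  rw [canonicalDensity_comp_cast_apply G ε f₀ e, canonicalDensity]
  congr 2
  rw [e]

/-- **The factorised marginal of the Gibbs-type weight** (GST 2013, proof of Prop. 6.1.2, second
step, in exact form): integrating `1_{D_ε^{s+p}} f₀^{⊗(s+p)}(Z_s, Z_p)` over the `p` added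
particles gives `1_{D_ε^s} f₀^{⊗s}(Z_s) · 𝒵_p[1_{S_ε(Z_s)} f₀]`, where `S_ε(Z_s)` is the set of
one-particle states `ε`-separated (in both orders of the separation vector) from every tagged
particle — the cross exclusion factor is absorbed into the reference density.
[cite: GST2013, Prop. 6.1.2 (proof, second step)] -/
theorem marginal_hsIndicator_tensorPow_eq (G : Geometry d X) (ε : ℝ)
    (f₀ : X × EuclideanSpace ℝ d → ℝ) (s p : ℕ) (Zs : Config s d X) :
    marginal s p ((hardSphereDomain G (s + p) ε).indicator (tensorPow (s + p) f₀)) Zs =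
      (hardSphereDomain G s ε).indicator (tensorPow s f₀) Zs *
        canonicalPartition G ε p ({z : X × EuclideanSpace ℝ d |
            ∀ i, ε ≤ ‖G.sepVec (Zs i).1 z.1‖ ∧ ε ≤ ‖G.sepVec z.1 (Zs i).1‖}.indicator f₀) := by
  rw [marginal, canonicalPartition, ← integral_const_mul]
  refine integral_congr_ae (ae_of_all _ fun zp => ?_)
  dsimp only
  rw [indicator_hardSphereDomain_tensorPow_append]

/-- **The marginals of the conditioned datum, exactly** (GST 2013 (6.1.7) in the proof of
Prop. 6.1.2: `f_{0,N}^{(s)} = 𝒵_N⁻¹ 1_{D_s} f₀^{⊗s} (𝒵_{N-s} - 𝒵^♭_{(s+1,N)})`; here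
`𝒵_{N-s} - 𝒵^♭ = 𝒵_{N-s}[1_{S_ε(Z_s)} f₀]`): for `s + p = N`,
`(𝒵_N⁻¹ 1_{D^N} f₀^{⊗N})^{(s)}(Z_s) = 𝒵_N⁻¹ · 1_{D_ε^s} f₀^{⊗s}(Z_s) · 𝒵_p[1_{S_ε(Z_s)} f₀]`.
[cite: GST2013, Prop. 6.1.2 (proof, second step, (6.1.7))] -/
theorem nthMarginal_canonicalDensity_eq (G : Geometry d X) (ε : ℝ)
    (f₀ : X × EuclideanSpace ℝ d → ℝ) {s p N : ℕ} (e : s + p = N) (Zs : Config s d X) :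
    nthMarginal N s (canonicalDensity G ε N f₀) Zs =
      (canonicalPartition G ε N f₀)⁻¹ *
        ((hardSphereDomain G s ε).indicator (tensorPow s f₀) Zs *
          canonicalPartition G ε p ({z : X × EuclideanSpace ℝ d |
            ∀ i, ε ≤ ‖G.sepVec (Zs i).1 z.1‖ ∧ ε ≤ ‖G.sepVec z.1 (Zs i).1‖}.indicator f₀)) := by
  have hs : s ≤ N := by omega
  have hk : N - s = p := by omega
  rw [nthMarginal_of_le hs, marginal_canonicalDensity_comp_cast G ε f₀ (Nat.add_sub_of_le hs) Zs,
    hk, marginal_hsIndicator_tensorPow_eq]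

variable [SigmaFinite (volume : Measure X)]

/-- Monotonicity of the canonical partition functions under restriction of the reference density
to a set of one-particle states: `𝒵_p[1_S f] ≤ 𝒵_p[f]` for `0 ≤ f` integrable. [folklore] -/
theorem canonicalPartition_indicator_le {G : Geometry d X}
    (hG : Measurable fun q : X × X => G.sepVec q.1 q.2) (ε : ℝ) (p : ℕ)
    {f : X × EuclideanSpace ℝ d → ℝ} (hf : 0 ≤ f) (hf' : Integrable f)
    (S : Set (X × EuclideanSpace ℝ d)) :
    canonicalPartition G ε p (S.indicator f) ≤ canonicalPartition G ε p f := by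
  have hSf : 0 ≤ S.indicator f := fun z => indicator_nonneg (fun w _ => hf w) z
  refine integral_mono_of_nonneg
    (ae_of_all _ fun z => indicator_nonneg (fun w _ => tensorPow_nonneg hSf p w) z)
    ((Literature.Analysis.FluidPDE.integrable_tensorPow p hf').indicator
      (measurableSet_hardSphereDomain G hG p ε))
    (ae_of_all _ fun z => ?_)
  refine indicator_le_indicator ?_
  exact Finset.prod_le_prod (fun j _ => hSf _) fun j _ => indicator_le_self' (fun _ _ => hf _) _

/-- **GST 2013 Prop. 6.1.2, first step** (the uniform bound, before the ratio lemma): for `0 ≤ f₀`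
integrable and `s ≤ N`, `f_{0,N}^{(s)}(Z_s) ≤ 𝒵_N⁻¹ 𝒵_{N-s} 1_{D_ε^s}(Z_s) f₀^{⊗s}(Z_s)`.
[cite: GST2013, Prop. 6.1.2 (proof, first step)] -/
theorem nthMarginal_canonicalDensity_le_ratio {G : Geometry d X}
    (hG : Measurable fun q : X × X => G.sepVec q.1 q.2) (ε : ℝ)
    {f₀ : X × EuclideanSpace ℝ d → ℝ} (hf₀0 : 0 ≤ f₀) (hf₀i : Integrable f₀) {N s : ℕ}
    (hs : s ≤ N) (Zs : Config s d X) :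
    nthMarginal N s (canonicalDensity G ε N f₀) Zs ≤
      (canonicalPartition G ε N f₀)⁻¹ * canonicalPartition G ε (N - s) f₀ *
        (hardSphereDomain G s ε).indicator (tensorPow s f₀) Zs := by
  rw [nthMarginal_canonicalDensity_eq G ε f₀ (Nat.add_sub_of_le hs) Zs, mul_assoc]
  refine mul_le_mul_of_nonneg_left ?_
    (inv_nonneg.2 (canonicalPartition_nonneg G ε N hf₀0))
  rw [mul_comm]
  exact mul_le_mul_of_nonneg_right (canonicalPartition_indicator_le hG ε (N - s) hf₀0 hf₀i _)
    (indicator_nonneg (fun w _ => tensorPow_nonneg hf₀0 s w) Zs)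

omit [SigmaFinite (volume : Measure X)] in
/-- The marginals of the conditioned datum vanish off the hard-sphere domain `D_ε^s`. [folklore] -/
theorem nthMarginal_canonicalDensity_eq_zero_of_notMem (G : Geometry d X) (ε : ℝ)
    (f₀ : X × EuclideanSpace ℝ d → ℝ) {N s : ℕ} (hs : s ≤ N) {Zs : Config s d X}
    (hZs : Zs ∉ hardSphereDomain G s ε) :
    nthMarginal N s (canonicalDensity G ε N f₀) Zs = 0 := by
  rw [nthMarginal_canonicalDensity_eq G ε f₀ (Nat.add_sub_of_le hs) Zs, indicator_of_notMem hZs,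
    zero_mul, mul_zero]

end General

/-! ## The ratio lemma on `T^d` for a general datum `0 ≤ f₀ ≤ C M_β` of mass one -/

section Torus

variable {d : Type*} [Fintype d]

variable {ε β C : ℝ} {f₀ : UnitAddTorus d × EuclideanSpace ℝ d → ℝ}

/-- `𝒵_{k+1} ≤ 𝒵_k`: integrating out the adjoined particle first and dropping the constraints
that involve it costs at most the mass `∫ f₀ = 1` (GST 2013 Lemma 6.1.2, `𝒵_N ≤ 𝒵_{N-s}`, i.e.
`1 ≤ 𝒵_N⁻¹ 𝒵_{N-s}`). [cite: GST2013, Lemma 6.1.2] -/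
theorem canonicalPartition_succ_le_of_mass_one (hβ : 0 < β) (hf₀m : Measurable f₀)
    (hf₀0 : 0 ≤ f₀) (hf₀b : ∀ z, f₀ z ≤ C * maxwellianBeta β z.2) (hf₀1 : ∫ z, f₀ z = 1)
    (k : ℕ) :
    canonicalPartition (Torus.geometry d) ε (k + 1) f₀ ≤
      canonicalPartition (Torus.geometry d) ε k f₀ := by
  have hf₀i : Integrable f₀ := integrable_of_le_maxwellianBeta hβ hf₀m hf₀0 hf₀b
  have hT0 : ∀ (l : ℕ) (w : Config l d (UnitAddTorus d)), 0 ≤ tensorPow l f₀ w :=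
    fun l w => tensorPow_nonneg hf₀0 l w
  rw [canonicalPartition_succ_eq_integral_integral hf₀i k, canonicalPartition]
  refine integral_mono (integrable_integral_indicator_tensorPow_cons hf₀i k)
    ((integrable_tensorPow hf₀i k).indicator (measurableSet_hardSphereDomain_torus k ε))
    fun zm => ?_
  have hpt : ∀ y : UnitAddTorus d × EuclideanSpace ℝ d,
      (hardSphereDomain (Torus.geometry d) (k + 1) ε).indicator
      (tensorPow (k + 1) f₀) (Fin.cons y zm) ≤
      f₀ y * (hardSphereDomain (Torus.geometry d) k ε).indicator (tensorPow k f₀) zm := by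
    intro y
    by_cases h : (Fin.cons y zm : Config (k + 1) d (UnitAddTorus d)) ∈
        hardSphereDomain (Torus.geometry d) (k + 1) ε
    · have hzm : zm ∈ hardSphereDomain (Torus.geometry d) k ε := by
        have h' := removeNth_mem_hardSphereDomain 0 h
        simpa [Fin.removeNth] using h'
      rw [indicator_of_mem h, indicator_of_mem hzm, tensorPow_cons]
    · rw [indicator_of_notMem h]
      exact mul_nonneg (hf₀0 _) (Set.indicator_nonneg (fun w _ => hT0 _ w) _)
  calc ∫ y : UnitAddTorus d × EuclideanSpace ℝ d,
        (hardSphereDomain (Torus.geometry d) (k + 1) ε).indicator (tensorPow (k + 1) f₀)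
          (Fin.cons y zm)
      ≤ ∫ y : UnitAddTorus d × EuclideanSpace ℝ d, f₀ y *
          (hardSphereDomain (Torus.geometry d) k ε).indicator (tensorPow k f₀) zm :=
        integral_mono_of_nonneg
          (Eventually.of_forall fun y => Set.indicator_nonneg (fun w _ => hT0 _ w) _)
          (hf₀i.mul_const _) (Eventually.of_forall hpt)
    _ = (hardSphereDomain (Torus.geometry d) k ε).indicator (tensorPow k f₀) zm := by
        rw [integral_mul_const, hf₀1, one_mul]

/-- `𝒵_l ≤ 𝒵_k` for `k ≤ l` (GST 2013 Lemma 6.1.2, `1 ≤ 𝒵_N⁻¹ 𝒵_{N-s}`).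
[cite: GST2013, Lemma 6.1.2] -/
theorem canonicalPartition_antitone_of_mass_one (hβ : 0 < β) (hf₀m : Measurable f₀)
    (hf₀0 : 0 ≤ f₀) (hf₀b : ∀ z, f₀ z ≤ C * maxwellianBeta β z.2) (hf₀1 : ∫ z, f₀ z = 1)
    {k l : ℕ} (h : k ≤ l) :
    canonicalPartition (Torus.geometry d) ε l f₀ ≤
      canonicalPartition (Torus.geometry d) ε k f₀ := by
  induction h with
  | refl => exact le_rfl
  | step _ ih => exact (canonicalPartition_succ_le_of_mass_one hβ hf₀m hf₀0 hf₀b hf₀1 _).trans ih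

/-- `𝒵_k ≤ 1` (`𝒵_0 = 1`). [cite: GST2013, Lemma 6.1.2] -/
theorem canonicalPartition_le_one_of_mass_one (hβ : 0 < β) (hf₀m : Measurable f₀)
    (hf₀0 : 0 ≤ f₀) (hf₀b : ∀ z, f₀ z ≤ C * maxwellianBeta β z.2) (hf₀1 : ∫ z, f₀ z = 1)
    (k : ℕ) : canonicalPartition (Torus.geometry d) ε k f₀ ≤ 1 :=
  (canonicalPartition_antitone_of_mass_one hβ hf₀m hf₀0 hf₀b hf₀1 (Nat.zero_le k)).trans_eq
    (canonicalPartition_zero ε f₀)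

/-- **GST 2013 Lemma 6.1.2, iterated on `T^d`**: `(1 - n (2ε)^d C)^j 𝒵_m ≤ 𝒵_{m+j}` whenever
`m + j ≤ n + 1` and `n (2ε)^d C ≤ 1` (each step is
`LanfordEmpirical.canonicalPartition_succ_ge`: `𝒵_{k+1} ≥ (1 - k (2ε)^d C) 𝒵_k`, `k ≤ n`;
printed: `𝒵_N ≥ 𝒵_{N-s} ∏_{j=N-s}^{N-1} (1 - j ε^d κ_d |f₀|_{L^∞L^1})`).
[cite: GST2013, Lemma 6.1.2] -/
theorem canonicalPartition_pow_mul_le_add (hβ : 0 < β) (hC : 0 ≤ C) (hε : 0 ≤ ε)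
    (hf₀m : Measurable f₀) (hf₀0 : 0 ≤ f₀) (hf₀b : ∀ z, f₀ z ≤ C * maxwellianBeta β z.2)
    (hf₀1 : ∫ z, f₀ z = 1) {n : ℕ} (hn : (n : ℝ) * (2 * ε) ^ Fintype.card d * C ≤ 1)
    (m j : ℕ) (hmj : m + j ≤ n + 1) :
    (1 - n * (2 * ε) ^ Fintype.card d * C) ^ j * canonicalPartition (Torus.geometry d) ε m f₀ ≤
      canonicalPartition (Torus.geometry d) ε (m + j) f₀ := by
  induction j with
  | zero => simp
  | succ j ih =>
    have hj : m + j ≤ n := by omega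
    have hstep := LanfordEmpirical.canonicalPartition_succ_ge (ε := ε) hβ hC hε hf₀m hf₀0 hf₀b
      hf₀1 (m + j)
    have hy0 : 0 ≤ (2 * ε) ^ Fintype.card d * C := by positivity
    have hfac : 1 - (n : ℝ) * (2 * ε) ^ Fintype.card d * C ≤
        1 - ((m + j : ℕ) : ℝ) * (2 * ε) ^ Fintype.card d * C := by
      have : ((m + j : ℕ) : ℝ) ≤ n := by exact_mod_cast hj
      nlinarith
    have h0 : 0 ≤ 1 - (n : ℝ) * (2 * ε) ^ Fintype.card d * C := by linarith
    calc (1 - (n : ℝ) * (2 * ε) ^ Fintype.card d * C) ^ (j + 1) *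
          canonicalPartition (Torus.geometry d) ε m f₀
        = (1 - (n : ℝ) * (2 * ε) ^ Fintype.card d * C) *
            ((1 - (n : ℝ) * (2 * ε) ^ Fintype.card d * C) ^ j *
              canonicalPartition (Torus.geometry d) ε m f₀) := by ring
      _ ≤ (1 - ((m + j : ℕ) : ℝ) * (2 * ε) ^ Fintype.card d * C) *
            canonicalPartition (Torus.geometry d) ε (m + j) f₀ :=
          mul_le_mul hfac (ih (by omega)) (mul_nonneg (pow_nonneg h0 _)
            (canonicalPartition_nonneg _ ε m hf₀0)) (h0.trans hfac)
      _ ≤ canonicalPartition (Torus.geometry d) ε (m + j + 1) f₀ := hstep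

/-- Positivity of the partition functions up to `N + 1` spheres when `N (2ε)^d C < 1`
(one step beyond `LanfordEmpirical.canonicalPartition_pos_of_lt`). [cite: GST2013, Lemma 6.1.2] -/
theorem canonicalPartition_pos_of_lt_succ (hβ : 0 < β) (hC : 0 ≤ C) (hε : 0 ≤ ε)
    (hf₀m : Measurable f₀) (hf₀0 : 0 ≤ f₀) (hf₀b : ∀ z, f₀ z ≤ C * maxwellianBeta β z.2)
    (hf₀1 : ∫ z, f₀ z = 1) {N : ℕ} (hN : (N : ℝ) * (2 * ε) ^ Fintype.card d * C < 1) :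
    ∀ m ≤ N + 1, 0 < canonicalPartition (Torus.geometry d) ε m f₀ := by
  intro m hm
  rcases Nat.lt_or_ge m (N + 1) with h | h
  · exact canonicalPartition_pos_of_lt hβ hC hε hf₀m hf₀0 hf₀b hf₀1 hN m (by omega)
  · have hmN : m = N + 1 := le_antisymm hm h
    subst hmN
    have hpos := canonicalPartition_pos_of_lt hβ hC hε hf₀m hf₀0 hf₀b hf₀1 hN N le_rfl
    have hstep := LanfordEmpirical.canonicalPartition_succ_ge (ε := ε) hβ hC hε hf₀m hf₀0 hf₀b
      hf₀1 N
    exact lt_of_lt_of_le (mul_pos (by linarith) hpos) hstep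

/-- **The ratio bounds of GST 2013 Lemma 6.1.2 on `T^d`, explicit form**: in the regime
`(N-1)(2ε)^d C ≤ 1/2`, for every `s ≤ N`,
`1 ≤ 𝒵_N⁻¹ 𝒵_{N-s} ≤ 1 + 2^{s+1} (N-1)(2ε)^d C` (printed: `≤ (1 - ε κ_d |f₀|)^{-s}`; here
`(1 - x)^{-s} ≤ (1 + 2x)^s ≤ 1 + (2^s - 1) 2x` for `x ≤ 1/2`). [cite: GST2013, Lemma 6.1.2] -/
theorem inv_mul_canonicalPartition_le_one_add (hβ : 0 < β) (hC : 0 ≤ C) (hε : 0 ≤ ε)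
    (hf₀m : Measurable f₀) (hf₀0 : 0 ≤ f₀) (hf₀b : ∀ z, f₀ z ≤ C * maxwellianBeta β z.2)
    (hf₀1 : ∫ z, f₀ z = 1) {N s : ℕ} (hs : s ≤ N)
    (hN : ((N - 1 : ℕ) : ℝ) * (2 * ε) ^ Fintype.card d * C ≤ 2⁻¹) :
    1 ≤ (canonicalPartition (Torus.geometry d) ε N f₀)⁻¹ *
        canonicalPartition (Torus.geometry d) ε (N - s) f₀ ∧
      (canonicalPartition (Torus.geometry d) ε N f₀)⁻¹ *
          canonicalPartition (Torus.geometry d) ε (N - s) f₀ ≤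
        1 + 2 ^ (s + 1) * (((N - 1 : ℕ) : ℝ) * (2 * ε) ^ Fintype.card d * C) := by
  set x : ℝ := ((N - 1 : ℕ) : ℝ) * (2 * ε) ^ Fintype.card d * C with hx
  have hx0 : 0 ≤ x := by positivity
  set ZN := canonicalPartition (Torus.geometry d) ε N f₀ with hZN
  set Zm := canonicalPartition (Torus.geometry d) ε (N - s) f₀ with hZm
  have hZNpos : 0 < ZN :=
    canonicalPartition_pos_of_lt_succ hβ hC hε hf₀m hf₀0 hf₀b hf₀1 (N := N - 1) (by linarith) N
      (by omega)
  have hZm0 : 0 ≤ Zm := canonicalPartition_nonneg _ ε _ hf₀0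
  have hmono : ZN ≤ Zm := canonicalPartition_antitone_of_mass_one hβ hf₀m hf₀0 hf₀b hf₀1 (by omega)
  refine ⟨?_, ?_⟩
  · rw [le_inv_mul_iff₀ hZNpos, mul_one]
    exact hmono
  have hchain : (1 - x) ^ s * Zm ≤ ZN := by
    have h := canonicalPartition_pow_mul_le_add (ε := ε) hβ hC hε hf₀m hf₀0 hf₀b hf₀1
      (n := N - 1) (by linarith) (N - s) s (by omega)
    rwa [Nat.sub_add_cancel hs] at h
  have hkey : 1 ≤ (1 - x) * (1 + 2 * x) := by nlinarith
  have hbound : Zm ≤ (1 + 2 * x) ^ s * ZN :=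
    calc Zm = Zm * 1 := (mul_one _).symm
      _ ≤ Zm * ((1 - x) * (1 + 2 * x)) ^ s := mul_le_mul_of_nonneg_left (one_le_pow₀ hkey) hZm0
      _ = (1 + 2 * x) ^ s * ((1 - x) ^ s * Zm) := by rw [mul_pow]; ring
      _ ≤ (1 + 2 * x) ^ s * ZN := mul_le_mul_of_nonneg_left hchain (by positivity)
  have hchord : (1 + 2 * x) ^ s ≤ 1 + 2 ^ (s + 1) * x := by
    refine (one_add_pow_le_one_add_mul (by positivity) (by linarith) s).trans ?_
    have : (2 ^ s - 1) * (2 * x) ≤ 2 ^ (s + 1) * x := by rw [pow_succ]; nlinarith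
    linarith
  rw [inv_mul_le_iff₀ hZNpos]
  calc Zm ≤ (1 + 2 * x) ^ s * ZN := hbound
    _ ≤ (1 + 2 ^ (s + 1) * x) * ZN := mul_le_mul_of_nonneg_right hchord hZNpos.le
    _ = ZN * (1 + 2 ^ (s + 1) * x) := mul_comm _ _

/-- In the same regime, `𝒵_N⁻¹ 𝒵_{N-s} ≤ 2^s` (from `(1 - x)^{-s}` with `x ≤ 1/2`); this is the
growth rate `b = 2` of the uniform Lanford-class bound of the conditioned data.
[cite: GST2013, Lemma 6.1.2 and Prop. 6.1.2 (proof, first step)] -/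
theorem inv_mul_canonicalPartition_le_two_pow (hβ : 0 < β) (hC : 0 ≤ C) (hε : 0 ≤ ε)
    (hf₀m : Measurable f₀) (hf₀0 : 0 ≤ f₀) (hf₀b : ∀ z, f₀ z ≤ C * maxwellianBeta β z.2)
    (hf₀1 : ∫ z, f₀ z = 1) {N s : ℕ} (hs : s ≤ N)
    (hN : ((N - 1 : ℕ) : ℝ) * (2 * ε) ^ Fintype.card d * C ≤ 2⁻¹) :
    (canonicalPartition (Torus.geometry d) ε N f₀)⁻¹ *
        canonicalPartition (Torus.geometry d) ε (N - s) f₀ ≤ 2 ^ s := by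
  set x : ℝ := ((N - 1 : ℕ) : ℝ) * (2 * ε) ^ Fintype.card d * C with hx
  set ZN := canonicalPartition (Torus.geometry d) ε N f₀ with hZN
  set Zm := canonicalPartition (Torus.geometry d) ε (N - s) f₀ with hZm
  have hZNpos : 0 < ZN :=
    canonicalPartition_pos_of_lt_succ hβ hC hε hf₀m hf₀0 hf₀b hf₀1 (N := N - 1) (by linarith) N
      (by omega)
  have hZm0 : 0 ≤ Zm := canonicalPartition_nonneg _ ε _ hf₀0
  have hchain : (1 - x) ^ s * Zm ≤ ZN := by
    have h := canonicalPartition_pow_mul_le_add (ε := ε) hβ hC hε hf₀m hf₀0 hf₀b hf₀1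
      (n := N - 1) (by linarith) (N - s) s (by omega)
    rwa [Nat.sub_add_cancel hs] at h
  have hhalf : (2⁻¹ : ℝ) ^ s * Zm ≤ ZN :=
    le_trans (mul_le_mul_of_nonneg_right (pow_le_pow_left₀ (by norm_num) (by linarith) s) hZm0)
      hchain
  rw [inv_mul_le_iff₀ hZNpos]
  calc Zm = 2 ^ s * ((2⁻¹ : ℝ) ^ s * Zm) := by rw [← mul_assoc, ← mul_pow]; norm_num
    _ ≤ 2 ^ s * ZN := mul_le_mul_of_nonneg_left hhalf (by positivity)
    _ = ZN * 2 ^ s := mul_comm _ _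

/-! ## The excluded volume around the tagged particles on `T^d` -/

/-- The `r`-neighbourhoods of the minimal-image distance of `T^d` have volume `≤ 2^d r^d`
(product of arcs; the printed `κ_d ε^d` on `ℝ^d`). [folklore] -/
theorem volume_ball_sepVec_le (x : (UnitAddTorus d)) (r : ℝ) (hr : 0 < r) :
    volume {y : (UnitAddTorus d) | ‖(Torus.geometry d).sepVec y x‖ < r} ≤
      (2 : ℝ≥0∞) ^ Fintype.card d * ENNReal.ofReal (r ^ Fintype.card d) := by
  have h := volume_setOf_euclidDist_lt_le (d := d) x hr.le
  refine h.trans (le_of_eq ?_)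
  rw [mul_pow, ENNReal.ofReal_mul (by positivity), ENNReal.ofReal_pow (by norm_num),
    ENNReal.ofReal_ofNat]

/-- **The excluded mass around `s` tagged spheres** (GST 2013, proof of Prop. 6.1.2, second
step: `𝒵^♭_{(s+1,N)} ≤ s (N-s) ε^d κ_d |f₀|_{L^∞L^1} 𝒵_{N-s-1}`, the one-particle factor): for
`0 ≤ f₀ ≤ C M_β` on `T^d × ℝ^d`, the mass of `f₀` over the states *not* `ε`-separated from the
tagged configuration `Z_s` is at most `s (2ε)^d C`.
[cite: GST2013, Prop. 6.1.2 (proof, second step)] -/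
theorem integral_indicator_compl_separated_torus_le (hβ : 0 < β) (hC : 0 ≤ C) (hf₀0 : 0 ≤ f₀)
    (hf₀b : ∀ z, f₀ z ≤ C * maxwellianBeta β z.2) {s : ℕ} (Zs : Config s d (UnitAddTorus d))
    (hε : 0 < ε) :
    ∫ z, ({z : UnitAddTorus d × EuclideanSpace ℝ d |
        ∀ i, ε ≤ ‖(Torus.geometry d).sepVec (Zs i).1 z.1‖ ∧
        ε ≤ ‖(Torus.geometry d).sepVec z.1 (Zs i).1‖}ᶜ).indicator f₀ z ≤
      s * (2 * ε) ^ Fintype.card d * C := by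
  have h := integral_indicator_compl_separated_le (G := Torus.geometry d)
    Torus.measurable_geometry_sepVec
    (fun x y => by
      rw [Torus.norm_geometry_sepVec, Torus.norm_geometry_sepVec, Torus.euclidDist_comm])
    (C := (2 : ℝ≥0∞) ^ Fintype.card d) (ENNReal.pow_ne_top ENNReal.ofNat_ne_top)
    (fun x r hr => volume_ball_sepVec_le x r hr) hf₀0 (g := fun v => C * maxwellianBeta β v)
    (fun v => mul_nonneg hC (maxwellianBeta_pos hβ v).le)
    ((integrable_maxwellianBeta hβ).const_mul C) (fun x v => hf₀b (x, v)) Zs hε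
  refine h.trans (le_of_eq ?_)
  rw [integral_const_mul, integral_maxwellianBeta hβ, mul_one, ENNReal.toReal_pow,
    ENNReal.toReal_ofNat, mul_pow]
  ring

/-! ## The two-sided estimate (GST 2013 Prop. 6.1.2 with explicit constants) -/

/-- **GST 2013 Prop. 6.1.2, first step with the ratio lemma, on `T^d`**: in the regime
`(N-1)(2ε)^d C ≤ 1/2`, for every `s ≤ N`,
`f_{0,N}^{(s)} ≤ (1 + 2^{s+1} (N-1)(2ε)^d C) 1_{D_ε^s} f₀^{⊗s}` (printed:
`f_{0,N}^{(s)} ≤ (1 - ε κ_d |f₀|_{L^∞L^1})^{-s} 1_{Z_s ∈ D_s} f₀^{⊗s}`).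
[cite: GST2013, Prop. 6.1.2 (proof, first step)] -/
theorem nthMarginal_canonicalDensity_le_one_add_mul (hβ : 0 < β) (hC : 0 ≤ C) (hε : 0 ≤ ε)
    (hf₀m : Measurable f₀) (hf₀0 : 0 ≤ f₀) (hf₀b : ∀ z, f₀ z ≤ C * maxwellianBeta β z.2)
    (hf₀1 : ∫ z, f₀ z = 1) {N s : ℕ} (hs : s ≤ N)
    (hN : ((N - 1 : ℕ) : ℝ) * (2 * ε) ^ Fintype.card d * C ≤ 2⁻¹)
    (Zs : Config s d (UnitAddTorus d)) :
    nthMarginal N s (canonicalDensity (Torus.geometry d) ε N f₀) Zs ≤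
      (1 + 2 ^ (s + 1) * (((N - 1 : ℕ) : ℝ) * (2 * ε) ^ Fintype.card d * C)) *
        (hardSphereDomain (Torus.geometry d) s ε).indicator (tensorPow s f₀) Zs := by
  have hf₀i : Integrable f₀ := integrable_of_le_maxwellianBeta hβ hf₀m hf₀0 hf₀b
  refine (nthMarginal_canonicalDensity_le_ratio Torus.measurable_geometry_sepVec ε hf₀0 hf₀i hs
    Zs).trans ?_
  exact mul_le_mul_of_nonneg_right
    (inv_mul_canonicalPartition_le_one_add hβ hC hε hf₀m hf₀0 hf₀b hf₀1 hs hN).2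
    (indicator_nonneg (fun w _ => tensorPow_nonneg hf₀0 s w) Zs)

/-- **The uniform Lanford-class bound of the conditioned data** (GST 2013 Prop. 6.1.2, first
step: `sup_N ‖F_{0,N}‖_{ε,β₀,μ₀'} < ∞`): in the regime `(N-1)(2ε)^d C ≤ 1/2`, for every `s ≤ N`,
`0 ≤ f_{0,N}^{(s)} ≤ 2^s 1_{D_ε^s} f₀^{⊗s}` (so `≤ (2C)^s (2π/β)^{ds/2}… e^{-β E(Z_s)}` for
`f₀ ≤ C M_β`). [cite: GST2013, Prop. 6.1.2 (proof, first step)] -/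
theorem nthMarginal_canonicalDensity_le_two_pow_mul (hβ : 0 < β) (hC : 0 ≤ C) (hε : 0 ≤ ε)
    (hf₀m : Measurable f₀) (hf₀0 : 0 ≤ f₀) (hf₀b : ∀ z, f₀ z ≤ C * maxwellianBeta β z.2)
    (hf₀1 : ∫ z, f₀ z = 1) {N s : ℕ} (hs : s ≤ N)
    (hN : ((N - 1 : ℕ) : ℝ) * (2 * ε) ^ Fintype.card d * C ≤ 2⁻¹)
    (Zs : Config s d (UnitAddTorus d)) :
    nthMarginal N s (canonicalDensity (Torus.geometry d) ε N f₀) Zs ≤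
      2 ^ s * (hardSphereDomain (Torus.geometry d) s ε).indicator (tensorPow s f₀) Zs := by
  have hf₀i : Integrable f₀ := integrable_of_le_maxwellianBeta hβ hf₀m hf₀0 hf₀b
  refine (nthMarginal_canonicalDensity_le_ratio Torus.measurable_geometry_sepVec ε hf₀0 hf₀i hs
    Zs).trans ?_
  exact mul_le_mul_of_nonneg_right
    (inv_mul_canonicalPartition_le_two_pow hβ hC hε hf₀m hf₀0 hf₀b hf₀1 hs hN)
    (indicator_nonneg (fun w _ => tensorPow_nonneg hf₀0 s w) Zs)

/-- **GST 2013 Prop. 6.1.2, second step, lower bound on `T^d`**: in the regime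
`(N-1)(2ε)^d C ≤ 1/2` (and `ε > 0`), for every `s ≤ N` and every `Z_s`,
`(1 - 2 s N (2ε)^d C) 1_{D_ε^s} f₀^{⊗s}(Z_s) ≤ f_{0,N}^{(s)}(Z_s)` (printed: the decomposition
(6.1.7)–(6.1.8) with `𝒵_N⁻¹ 𝒵^♭_{(s+1,N)} ≤ ε s κ_d |f₀| (1 - ε κ_d |f₀|)^{-(s+1)}` and
`1 - 𝒵_N⁻¹ 𝒵_{N-s} ≤ 0`). [cite: GST2013, Prop. 6.1.2 (proof, second step)] -/
theorem nthMarginal_canonicalDensity_ge_one_sub_mul (hβ : 0 < β) (hC : 0 ≤ C) (hε : 0 < ε)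
    (hf₀m : Measurable f₀) (hf₀0 : 0 ≤ f₀) (hf₀b : ∀ z, f₀ z ≤ C * maxwellianBeta β z.2)
    (hf₀1 : ∫ z, f₀ z = 1) {N s : ℕ} (hs : s ≤ N)
    (hN : ((N - 1 : ℕ) : ℝ) * (2 * ε) ^ Fintype.card d * C ≤ 2⁻¹)
    (Zs : Config s d (UnitAddTorus d)) :
    (1 - 2 * s * N * ((2 * ε) ^ Fintype.card d * C)) *
        (hardSphereDomain (Torus.geometry d) s ε).indicator (tensorPow s f₀) Zs ≤
      nthMarginal N s (canonicalDensity (Torus.geometry d) ε N f₀) Zs := by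
  have hf₀i : Integrable f₀ := integrable_of_le_maxwellianBeta hβ hf₀m hf₀0 hf₀b
  have hy0 : 0 ≤ (2 * ε) ^ Fintype.card d * C := by positivity
  have hW0 : 0 ≤ (hardSphereDomain (Torus.geometry d) s ε).indicator (tensorPow s f₀) Zs :=
    indicator_nonneg (fun w _ => tensorPow_nonneg hf₀0 s w) Zs
  have hnn : 0 ≤ nthMarginal N s (canonicalDensity (Torus.geometry d) ε N f₀) Zs :=
    nthMarginal_nonneg N s (canonicalDensity_nonneg' hf₀0) Zs
  -- trivial when the prefactor is nonpositive
  by_cases hc : 1 - 2 * (s : ℝ) * N * ((2 * ε) ^ Fintype.card d * C) ≤ 0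
  · exact (mul_nonpos_of_nonpos_of_nonneg hc hW0).trans hnn
  push Not at hc
  -- positivity of the partition functions up to `N`, and `𝒵_N ≤ 1`
  have hZpos : ∀ k ≤ N, 0 < canonicalPartition (Torus.geometry d) ε k f₀ := fun k hk =>
    canonicalPartition_pos_of_lt_succ hβ hC hε.le hf₀m hf₀0 hf₀b hf₀1 (N := N - 1) (by linarith)
      k (by omega)
  have hZle1 := canonicalPartition_le_one_of_mass_one (ε := ε) hβ hf₀m hf₀0 hf₀b hf₀1 N
  have hZNpos := hZpos N le_rfl
  obtain ⟨p, hp⟩ : ∃ p, N - s = p := ⟨N - s, rfl⟩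
  have e : s + p = N := by omega
  rw [nthMarginal_canonicalDensity_eq (Torus.geometry d) ε f₀ e Zs] at hnn ⊢
  cases p with
  | zero =>
    -- `s = N`: the marginal is `𝒵_N⁻¹ 1_D f₀^{⊗N} · 𝒵_0[…] = 𝒵_N⁻¹ 1_D f₀^{⊗N} ≥ 1_D f₀^{⊗N}`
    rw [canonicalPartition_zero, mul_one]
    have hZ1 : 1 ≤ (canonicalPartition (Torus.geometry d) ε N f₀)⁻¹ := (one_le_inv₀ hZNpos).2 hZle1
    have h0 : 0 ≤ 2 * (s : ℝ) * N * ((2 * ε) ^ Fintype.card d * C) := by positivity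
    calc (1 - 2 * (s : ℝ) * N * ((2 * ε) ^ Fintype.card d * C)) *
          (hardSphereDomain (Torus.geometry d) s ε).indicator (tensorPow s f₀) Zs
        ≤ 1 * (hardSphereDomain (Torus.geometry d) s ε).indicator (tensorPow s f₀) Zs :=
          mul_le_mul_of_nonneg_right (by linarith) hW0
      _ ≤ (canonicalPartition (Torus.geometry d) ε N f₀)⁻¹ *
            (hardSphereDomain (Torus.geometry d) s ε).indicator (tensorPow s f₀) Zs :=
          mul_le_mul_of_nonneg_right hZ1 hW0
  | succ n =>
    -- the excluded mass around the tagged spheres (before abbreviating the separated set)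
    have hmass := integral_indicator_compl_separated_torus_le hβ hC hf₀0 hf₀b Zs hε
    set S : Set (UnitAddTorus d × EuclideanSpace ℝ d) :=
      {z : UnitAddTorus d × EuclideanSpace ℝ d | ∀ i, ε ≤ ‖(Torus.geometry d).sepVec (Zs i).1 z.1‖ ∧
        ε ≤ ‖(Torus.geometry d).sepVec z.1 (Zs i).1‖} with hS
    have hSm : MeasurableSet S := by
      rw [hS]
      exact measurableSet_separated Torus.measurable_geometry_sepVec ε Zs
    have hmass0 : 0 ≤ ∫ z, Sᶜ.indicator f₀ z :=
      integral_nonneg fun z => indicator_nonneg (fun w _ => hf₀0 w) z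
    -- first-order exclusion, one step of the ratio lemma, monotonicity
    have hexcl := canonicalPartition_succ_sub_indicator_le (G := Torus.geometry d)
      Torus.measurable_geometry_sepVec ε n hf₀0 hf₀i hSm
    have hstep := LanfordEmpirical.canonicalPartition_succ_ge (ε := ε) hβ hC hε.le hf₀m hf₀0 hf₀b
      hf₀1 n
    have hanti : canonicalPartition (Torus.geometry d) ε N f₀ ≤
        canonicalPartition (Torus.geometry d) ε (n + 1) f₀ :=
      canonicalPartition_antitone_of_mass_one hβ hf₀m hf₀0 hf₀b hf₀1 (by omega)
    have hZp0 : 0 < canonicalPartition (Torus.geometry d) ε (n + 1) f₀ := hZpos (n + 1) (by omega)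
    have hZn0 : 0 ≤ canonicalPartition (Torus.geometry d) ε n f₀ :=
      canonicalPartition_nonneg _ ε n hf₀0
    have hnN : (n : ℝ) ≤ ((N - 1 : ℕ) : ℝ) := by exact_mod_cast (show n ≤ N - 1 by omega)
    have hn1N : ((n : ℝ) + 1) ≤ N := by exact_mod_cast (show n + 1 ≤ N by omega)
    -- abbreviations
    set y : ℝ := (2 * ε) ^ Fintype.card d * C with hy
    set W : ℝ := (hardSphereDomain (Torus.geometry d) s ε).indicator (tensorPow s f₀) Zs with hW
    set ZN := canonicalPartition (Torus.geometry d) ε N f₀ with hZN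
    set Zp := canonicalPartition (Torus.geometry d) ε (n + 1) f₀ with hZp
    set Zn := canonicalPartition (Torus.geometry d) ε n f₀ with hZn
    set ZS := canonicalPartition (Torus.geometry d) ε (n + 1) (S.indicator f₀) with hZS
    set m : ℝ := ∫ z, Sᶜ.indicator f₀ z with hm
    have hN' : ((N - 1 : ℕ) : ℝ) * y ≤ 2⁻¹ := by
      have : ((N - 1 : ℕ) : ℝ) * y = ((N - 1 : ℕ) : ℝ) * (2 * ε) ^ Fintype.card d * C := by
        rw [hy]; ring
      rw [this]; exact hN
    have hmass' : m ≤ s * y := by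
      have : (s : ℝ) * y = s * (2 * ε) ^ Fintype.card d * C := by rw [hy]; ring
      rw [this]; exact hmass
    have hstep' : (1 - n * y) * Zn ≤ Zp := by
      have : (1 - (n : ℝ) * y) = 1 - n * (2 * ε) ^ Fintype.card d * C := by rw [hy]; ring
      rw [this]; exact hstep
    -- `Zp - (n+1) s y Zn ≤ ZS`
    have hZS_ge : Zp - (n + 1) * (s * y) * Zn ≤ ZS := by
      have : (n + 1 : ℝ) * m * Zn ≤ (n + 1) * (s * y) * Zn :=
        mul_le_mul_of_nonneg_right (mul_le_mul_of_nonneg_left hmass' (by positivity)) hZn0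
      linarith
    -- `Zn ≤ 2 Zp`
    have hny : (n : ℝ) * y ≤ 2⁻¹ := le_trans (mul_le_mul_of_nonneg_right hnN hy0) hN'
    have hZn_le : Zn ≤ 2 * Zp := by
      have : (2⁻¹ : ℝ) * Zn ≤ (1 - n * y) * Zn := mul_le_mul_of_nonneg_right (by linarith) hZn0
      linarith
    have hZS_ge' : Zp * (1 - 2 * s * (n + 1) * y) ≤ ZS := by
      have : (n + 1 : ℝ) * (s * y) * Zn ≤ (n + 1) * (s * y) * (2 * Zp) :=
        mul_le_mul_of_nonneg_left hZn_le (by positivity)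
      have hid : Zp * (1 - 2 * s * (n + 1) * y) = Zp - (n + 1) * (s * y) * (2 * Zp) := by ring
      rw [hid]
      linarith
    -- `𝒵_N⁻¹ Zp ≥ 1`
    have hratio : 1 ≤ ZN⁻¹ * Zp := by
      rw [le_inv_mul_iff₀ hZNpos, mul_one]
      exact hanti
    have hsy : 0 ≤ (s : ℝ) * y := mul_nonneg (Nat.cast_nonneg s) hy0
    have hcn : 1 - 2 * (s : ℝ) * N * y ≤ 1 - 2 * s * (n + 1) * y := by nlinarith
    have hc' : 0 < 1 - 2 * (s : ℝ) * (n + 1) * y := hc.trans_le hcn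
    calc (1 - 2 * (s : ℝ) * N * y) * W ≤ (1 - 2 * s * (n + 1) * y) * W :=
          mul_le_mul_of_nonneg_right hcn hW0
      _ ≤ (ZN⁻¹ * Zp) * ((1 - 2 * s * (n + 1) * y) * W) :=
          le_mul_of_one_le_left (mul_nonneg hc'.le hW0) hratio
      _ = ZN⁻¹ * (W * (Zp * (1 - 2 * s * (n + 1) * y))) := by ring
      _ ≤ ZN⁻¹ * (W * ZS) :=
          mul_le_mul_of_nonneg_left (mul_le_mul_of_nonneg_left hZS_ge' hW0)
            (inv_nonneg.2 hZNpos.le)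

/-- **GST 2013 Prop. 6.1.2 on `T^d`, two-sided with explicit constants**: in the regime
`(N-1)(2ε)^d C ≤ 1/2`, `ε > 0`, for every `s ≤ N` and every configuration `Z_s`,
`|f_{0,N}^{(s)}(Z_s) - 1_{D_ε^s} f₀^{⊗s}(Z_s)| ≤ (s+1) 2^{s+1} N (2ε)^d C · 1_{D_ε^s} f₀^{⊗s}(Z_s)`
(printed: "the uniform convergence `f_{0,N}^{(s)} - 1_{Z_s ∈ D_s} f₀^{⊗s} → 0` in `Ω_s`" with
the two rates `1 - 𝒵_N⁻¹𝒵_{N-s}` and `𝒵_N⁻¹ 𝒵^♭_{(s+1,N)} ≤ ε s κ_d |f₀| (1 - εκ_d|f₀|)^{-(s+1)}`;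
in the scaling `N ε^{d-1} ≡ 1` the right-hand side is `O_s(ε)`).
[cite: GST2013, Prop. 6.1.2 (proof, second step)] -/
theorem abs_nthMarginal_canonicalDensity_sub_le (hβ : 0 < β) (hC : 0 ≤ C) (hε : 0 < ε)
    (hf₀m : Measurable f₀) (hf₀0 : 0 ≤ f₀) (hf₀b : ∀ z, f₀ z ≤ C * maxwellianBeta β z.2)
    (hf₀1 : ∫ z, f₀ z = 1) {N s : ℕ} (hs : s ≤ N)
    (hN : ((N - 1 : ℕ) : ℝ) * (2 * ε) ^ Fintype.card d * C ≤ 2⁻¹)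
    (Zs : Config s d (UnitAddTorus d)) :
    |nthMarginal N s (canonicalDensity (Torus.geometry d) ε N f₀) Zs -
        (hardSphereDomain (Torus.geometry d) s ε).indicator (tensorPow s f₀) Zs| ≤
      ((s + 1) * 2 ^ (s + 1) * N * ((2 * ε) ^ Fintype.card d * C)) *
        (hardSphereDomain (Torus.geometry d) s ε).indicator (tensorPow s f₀) Zs := by
  set y : ℝ := (2 * ε) ^ Fintype.card d * C with hy
  have hy0 : 0 ≤ y := by positivity
  set W : ℝ := (hardSphereDomain (Torus.geometry d) s ε).indicator (tensorPow s f₀) Zs with hW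
  have hW0 : 0 ≤ W := indicator_nonneg (fun w _ => tensorPow_nonneg hf₀0 s w) Zs
  have hup := nthMarginal_canonicalDensity_le_one_add_mul hβ hC hε.le hf₀m hf₀0 hf₀b hf₀1 hs hN Zs
  have hlo := nthMarginal_canonicalDensity_ge_one_sub_mul hβ hC hε hf₀m hf₀0 hf₀b hf₀1 hs hN Zs
  have hN1 : ((N - 1 : ℕ) : ℝ) ≤ N := by exact_mod_cast Nat.sub_le N 1
  have h2s : (1 : ℝ) ≤ 2 ^ s := one_le_pow₀ (by norm_num)
  have hx : ((N - 1 : ℕ) : ℝ) * (2 * ε) ^ Fintype.card d * C = ((N - 1 : ℕ) : ℝ) * y := by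
    rw [hy]; ring
  rw [hx] at hup
  rw [abs_le]
  constructor
  · have : 2 * (s : ℝ) * N * y ≤ (s + 1) * 2 ^ (s + 1) * N * y := by
      rw [pow_succ]
      have : 2 * (s : ℝ) ≤ (s + 1) * (2 ^ s * 2) := by nlinarith
      exact mul_le_mul_of_nonneg_right (mul_le_mul_of_nonneg_right this (Nat.cast_nonneg N)) hy0
    nlinarith
  · have : 2 ^ (s + 1) * (((N - 1 : ℕ) : ℝ) * y) ≤ (s + 1) * 2 ^ (s + 1) * N * y := by
      have h1 : 2 ^ (s + 1) * (((N - 1 : ℕ) : ℝ) * y) ≤ 2 ^ (s + 1) * (N * y) :=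
        mul_le_mul_of_nonneg_left (mul_le_mul_of_nonneg_right hN1 hy0) (by positivity)
      have h2 : 2 ^ (s + 1) * ((N : ℝ) * y) ≤ (s + 1) * 2 ^ (s + 1) * N * y := by
        have : (1 : ℝ) ≤ s + 1 := by linarith [Nat.cast_nonneg (α := ℝ) s]
        nlinarith [mul_nonneg (mul_nonneg (by positivity : (0 : ℝ) ≤ 2 ^ (s + 1))
          (Nat.cast_nonneg N)) hy0]
      linarith
    nlinarith

/-! ## Along an exact Boltzmann–Grad sequence: the rate `N_k (2ε_k)^d C = 2^d C ε_k → 0` -/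

section BoltzmannGrad

variable {N : ℕ → ℕ} {εk : ℕ → ℝ}

/-- In the exact Boltzmann–Grad scaling `N_k ε_k^{d-1} = 1` (`d ≥ 1 + 1`), the total excluded
mass is `N_k (2ε_k)^d C = 2^d C ε_k` (GST 2013 Lemma 6.1.2: "where we used `s ≤ N` and the
scaling `N ε^{d-1} ≡ 1`"). [cite: GST2013, Lemma 6.1.2] -/
theorem excludedMass_eq_of_exact (hd : 2 ≤ Fintype.card d)
    (hNε : IsBoltzmannGradSequenceExact d 1 N εk) (C : ℝ) (k : ℕ) :
    (N k : ℝ) * (2 * εk k) ^ Fintype.card d * C = 2 ^ Fintype.card d * C * εk k := by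
  obtain ⟨c, hc⟩ : ∃ c, Fintype.card d = c + 1 := ⟨Fintype.card d - 1, by omega⟩
  have hk : (N k : ℝ) * εk k ^ c = 1 := by
    have h := hNε.2.2 k
    simp only [hc, Nat.add_sub_cancel] at h
    exact h
  rw [hc]
  calc (N k : ℝ) * (2 * εk k) ^ (c + 1) * C
      = 2 ^ (c + 1) * C * ((N k : ℝ) * εk k ^ c) * εk k := by rw [mul_pow, pow_succ (εk k)]; ring
    _ = 2 ^ (c + 1) * C * εk k := by rw [hk, mul_one]

/-- Hence `N_k (2ε_k)^d C → 0`. [cite: GST2013, Lemma 6.1.2] -/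
theorem tendsto_excludedMass_of_exact (hd : 2 ≤ Fintype.card d)
    (hNε : IsBoltzmannGradSequenceExact d 1 N εk) (C : ℝ) :
    Tendsto (fun k => (N k : ℝ) * (2 * εk k) ^ Fintype.card d * C) atTop (𝓝 0) := by
  have ht : Tendsto (fun k => 2 ^ Fintype.card d * C * εk k) atTop (𝓝 0) := by
    simpa using hNε.2.1.const_mul (2 ^ Fintype.card d * C)
  exact ht.congr fun k => (excludedMass_eq_of_exact hd hNε C k).symm

/-- The rate of Prop. 6.1.2 at level `s`, `(s+1) 2^{s+1} N_k (2ε_k)^d C`, tends to `0`.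
[cite: GST2013, Prop. 6.1.2 (proof, second step)] -/
theorem tendsto_rate_of_exact (hd : 2 ≤ Fintype.card d)
    (hNε : IsBoltzmannGradSequenceExact d 1 N εk) (C : ℝ) (s : ℕ) :
    Tendsto (fun k => (s + 1) * 2 ^ (s + 1) * (N k : ℝ) * ((2 * εk k) ^ Fintype.card d * C))
      atTop (𝓝 0) := by
  have h := (tendsto_excludedMass_of_exact hd hNε C).const_mul ((s + 1 : ℝ) * 2 ^ (s + 1))
  rw [mul_zero] at h
  exact h.congr fun k => by ring

/-- Eventually along the sequence the regime `(N_k - 1)(2ε_k)^d C ≤ 1/2` of the two-sided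
estimate holds (for `C ≥ 0`). [cite: GST2013, Lemma 6.1.2] -/
theorem eventually_regime_of_exact (hd : 2 ≤ Fintype.card d)
    (hNε : IsBoltzmannGradSequenceExact d 1 N εk) (hC : 0 ≤ C) :
    ∀ᶠ k in atTop, ((N k - 1 : ℕ) : ℝ) * (2 * εk k) ^ Fintype.card d * C ≤ 2⁻¹ := by
  have h := (tendsto_excludedMass_of_exact hd hNε C).eventually
    (Iio_mem_nhds (show (0 : ℝ) < 2⁻¹ by norm_num))
  filter_upwards [h] with k hk
  refine le_trans ?_ (le_of_lt hk)
  have h1 : ((N k - 1 : ℕ) : ℝ) ≤ N k := by exact_mod_cast Nat.sub_le _ _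
  have hy : 0 ≤ (2 * εk k) ^ Fintype.card d * C :=
    mul_nonneg (pow_nonneg (mul_nonneg zero_le_two (hNε.1 k).le) _) hC
  nlinarith

/-- **Uniform convergence of the conditioned data with the explicit rate, eventually along an
exact Boltzmann–Grad sequence** (GST 2013 Prop. 6.1.2, second step: "the uniform convergence
`f_{0,N}^{(s)} - 1_{Z_s ∈ D_s} f₀^{⊗s} → 0` in `Ω_s`"): eventually in `k`, for all `s ≤ N_k`
and all `Z_s`,
`|f_{0,N_k}^{(s)}(Z_s) - 1_{D_{ε_k}^s} f₀^{⊗s}(Z_s)| ≤ r_k^{(s)} 1_{D_{ε_k}^s} f₀^{⊗s}(Z_s)` and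
`0 ≤ f_{0,N_k}^{(s)} ≤ 2^s 1_{D_{ε_k}^s} f₀^{⊗s}`, with
`r_k^{(s)} = (s+1) 2^{s+1} N_k (2ε_k)^d C → 0` (`tendsto_rate_of_exact`).
[cite: GST2013, Prop. 6.1.2] -/
theorem eventually_abs_nthMarginal_canonicalDensity_sub_le (hd : 2 ≤ Fintype.card d)
    (hβ : 0 < β) (hC : 0 ≤ C) (hf₀m : Measurable f₀) (hf₀0 : 0 ≤ f₀)
    (hf₀b : ∀ z, f₀ z ≤ C * maxwellianBeta β z.2) (hf₀1 : ∫ z, f₀ z = 1)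
    (hNε : IsBoltzmannGradSequenceExact d 1 N εk) :
    ∀ᶠ k in atTop, ∀ s ≤ N k, ∀ Zs : Config s d (UnitAddTorus d),
      |nthMarginal (N k) s (canonicalDensity (Torus.geometry d) (εk k) (N k) f₀) Zs -
          (hardSphereDomain (Torus.geometry d) s (εk k)).indicator (tensorPow s f₀) Zs| ≤
        ((s + 1) * 2 ^ (s + 1) * (N k : ℝ) * ((2 * εk k) ^ Fintype.card d * C)) *
          (hardSphereDomain (Torus.geometry d) s (εk k)).indicator (tensorPow s f₀) Zs ∧
      0 ≤ nthMarginal (N k) s (canonicalDensity (Torus.geometry d) (εk k) (N k) f₀) Zs ∧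
      nthMarginal (N k) s (canonicalDensity (Torus.geometry d) (εk k) (N k) f₀) Zs ≤
        2 ^ s * (hardSphereDomain (Torus.geometry d) s (εk k)).indicator (tensorPow s f₀) Zs := by
  filter_upwards [eventually_regime_of_exact hd hNε hC] with k hk s hs Zs
  exact ⟨abs_nthMarginal_canonicalDensity_sub_le hβ hC (hNε.1 k) hf₀m hf₀0 hf₀b hf₀1 hs hk Zs,
    nthMarginal_nonneg (N k) s (canonicalDensity_nonneg' hf₀0) Zs,
    nthMarginal_canonicalDensity_le_two_pow_mul hβ hC (hNε.1 k).le hf₀m hf₀0 hf₀b hf₀1 hs hk Zs⟩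

end BoltzmannGrad

/-! ## Chaos of the conditioned data: pointwise off the diagonal, and in mode A -/

section Convergence

variable {N : ℕ → ℕ} {εk : ℕ → ℝ}

/-- Distinct points of `T^d` are at positive minimal-image distance. [folklore] -/
theorem euclidDist_pos_of_ne {x y : (UnitAddTorus d)} (h : x ≠ y) : 0 < Torus.euclidDist x y :=
  lt_of_lt_of_le (norm_pos_iff.2 (sub_ne_zero.2 h)) (Torus.norm_sub_le_euclidDist_holds x y)

/-- Along a sequence of diameters `ε_k → 0`, a compact set of position configurations off the
diagonal eventually consists of configurations in the hard-sphere position domain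
`{∀ i ≠ j, ε_k ≤ |x_i - x_j|}` (GST 2013 Lemma 6.2.2: "for `ε` sufficiently small,
`1_{Z_s ∈ D_s} = 1`" on compact subsets of `Ω_s`). [cite: GST2013, Lemma 6.2.2] -/
theorem eventually_forall_le_euclidDist {s : ℕ} {K : Set (Fin s → (UnitAddTorus d))}
    (hK : K ⊆ Literature.Analysis.FluidPDE.offDiag (X := (UnitAddTorus d)) s) (hKc : IsCompact K)
    (hε : Tendsto εk atTop (𝓝 0)) :
    ∀ᶠ k in atTop, ∀ xs ∈ K, ∀ i j, i ≠ j → εk k ≤ Torus.euclidDist (xs i) (xs j) := by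
  have key : ∀ q : Fin s × Fin s, ∀ᶠ k in atTop, ∀ xs ∈ K, q.1 ≠ q.2 →
      εk k ≤ Torus.euclidDist (xs q.1) (xs q.2) := by
    intro q
    by_cases hq : q.1 = q.2
    · exact Eventually.of_forall fun k xs _ h => absurd hq h
    rcases K.eq_empty_or_nonempty with hKe | hKne
    · refine Eventually.of_forall fun k xs hxs => ?_
      rw [hKe] at hxs
      exact absurd hxs (Set.notMem_empty xs)
    have h1 : Continuous fun xs : Fin s → (UnitAddTorus d) => (xs q.1, xs q.2) :=
      (continuous_apply q.1).prodMk (continuous_apply q.2)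
    have h2 := (Torus.continuous_euclidDist (d := d)).comp h1
    have hcont :
        Continuous fun xs : Fin s → (UnitAddTorus d) => Torus.euclidDist (xs q.1) (xs q.2) := h2
    obtain ⟨x₀, hx₀K, hmin⟩ := hKc.exists_isMinOn hKne hcont.continuousOn
    have hmin' := isMinOn_iff.1 hmin
    have hpos : 0 < Torus.euclidDist (x₀ q.1) (x₀ q.2) :=
      euclidDist_pos_of_ne ((mem_offDiag.1 (hK hx₀K)) q.1 q.2 hq)
    filter_upwards [hε.eventually (Iio_mem_nhds hpos)] with k hk xs hxs _
    exact (mem_Iio.1 hk).le.trans (hmin' xs hxs)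
  filter_upwards [eventually_all.2 key] with k hk xs hxs i j hij
  exact hk (i, j) xs hxs hij

/-- **GST 2013 Prop. 6.1.2 on `T^d`, the convergence statement**: along an exact
Boltzmann–Grad sequence `N_k ε_k^{d-1} = 1`, `d ≥ 2`, for a datum `0 ≤ f₀ ≤ C M_β` of mass one,
the marginals of the conditioned data converge to the tensor powers,
`f_{0,N_k}^{(s)}(Z_s) → f₀^{⊗s}(Z_s)`, at every configuration `Z_s` with pairwise distinct
positions (printed: "`f_{0,N}^{(s)}` converges locally uniformly to `f₀^{⊗s}` in `Ω_s`"; the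
uniformity is `eventually_abs_nthMarginal_canonicalDensity_sub_le`). [cite: GST2013, Prop. 6.1.2] -/
theorem tendsto_nthMarginal_canonicalDensity (hd : 2 ≤ Fintype.card d) (hβ : 0 < β) (hC : 0 ≤ C)
    (hf₀m : Measurable f₀) (hf₀0 : 0 ≤ f₀) (hf₀b : ∀ z, f₀ z ≤ C * maxwellianBeta β z.2)
    (hf₀1 : ∫ z, f₀ z = 1) (hNε : IsBoltzmannGradSequenceExact d 1 N εk) {s : ℕ}
    {Zs : Config s d (UnitAddTorus d)} (hZs : ∀ i j, i ≠ j → (Zs i).1 ≠ (Zs j).1) :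
    Tendsto (fun k => nthMarginal (N k) s (canonicalDensity (Torus.geometry d) (εk k) (N k) f₀) Zs)
      atTop (𝓝 (tensorPow s f₀ Zs)) := by
  have hr0 := tendsto_rate_of_exact hd hNε C s
  -- eventually: the estimate, `s ≤ N_k`, and `Z_s ∈ D_{ε_k}^s`
  have hsN : ∀ᶠ k in atTop, s ≤ N k :=
    (hNε.isBoltzmannGradSequence.tendsto_atTop hd one_ne_zero).eventually_ge_atTop s
  have hsep : ∀ᶠ k in atTop, Zs ∈ hardSphereDomain (Torus.geometry d) s (εk k) := by
    have h := eventually_forall_le_euclidDist (εk := εk) (s := s) (K := {fun i => (Zs i).1})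
      (fun xs hxs => by
        rw [mem_singleton_iff] at hxs
        subst hxs
        exact fun i j hij => hZs i j hij)
      isCompact_singleton hNε.2.1
    filter_upwards [h] with k hk
    exact mem_hardSphereDomain.2 fun i j hij => by
      rw [Torus.norm_geometry_sepVec]
      exact hk _ (mem_singleton _) i j hij
  have hboth : ∀ᶠ k in atTop,
      tensorPow s f₀ Zs - (s + 1) * 2 ^ (s + 1) * (N k : ℝ) * ((2 * εk k) ^ Fintype.card d * C) *
          tensorPow s f₀ Zs ≤
        nthMarginal (N k) s (canonicalDensity (Torus.geometry d) (εk k) (N k) f₀) Zs ∧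
      nthMarginal (N k) s (canonicalDensity (Torus.geometry d) (εk k) (N k) f₀) Zs ≤
        tensorPow s f₀ Zs + (s + 1) * 2 ^ (s + 1) * (N k : ℝ) * ((2 * εk k) ^ Fintype.card d * C) *
          tensorPow s f₀ Zs := by
    filter_upwards [eventually_abs_nthMarginal_canonicalDensity_sub_le hd hβ hC hf₀m hf₀0 hf₀b hf₀1
      hNε, hsN, hsep] with k hk hks hkD
    have h := (hk s hks Zs).1
    rw [indicator_of_mem hkD] at h
    constructor <;> linarith [(abs_le.1 h).1, (abs_le.1 h).2]
  have hlow : Tendsto (fun k => tensorPow s f₀ Zs -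
      (s + 1) * 2 ^ (s + 1) * (N k : ℝ) * ((2 * εk k) ^ Fintype.card d * C) * tensorPow s f₀ Zs)
      atTop (𝓝 (tensorPow s f₀ Zs)) := by
    have h : Tendsto (fun k => tensorPow s f₀ Zs -
        (s + 1) * 2 ^ (s + 1) * (N k : ℝ) * ((2 * εk k) ^ Fintype.card d * C) * tensorPow s f₀ Zs)
        atTop (𝓝 (tensorPow s f₀ Zs - 0 * tensorPow s f₀ Zs)) :=
      tendsto_const_nhds.sub (hr0.mul_const _)
    rwa [zero_mul, sub_zero] at h
  have hup : Tendsto (fun k => tensorPow s f₀ Zs +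
      (s + 1) * 2 ^ (s + 1) * (N k : ℝ) * ((2 * εk k) ^ Fintype.card d * C) * tensorPow s f₀ Zs)
      atTop (𝓝 (tensorPow s f₀ Zs)) := by
    have h : Tendsto (fun k => tensorPow s f₀ Zs +
        (s + 1) * 2 ^ (s + 1) * (N k : ℝ) * ((2 * εk k) ^ Fintype.card d * C) * tensorPow s f₀ Zs)
        atTop (𝓝 (tensorPow s f₀ Zs + 0 * tensorPow s f₀ Zs)) :=
      tendsto_const_nhds.add (hr0.mul_const _)
    rwa [zero_mul, add_zero] at h
  exact tendsto_of_tendsto_of_tendsto_of_le_of_le' hlow hup (hboth.mono fun k h => h.1)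
    (hboth.mono fun k h => h.2)

omit [Fintype d] in
/-- Juxtaposing fixed positions with variable velocities is measurable. [folklore] -/
theorem measurable_zipVel' {s : ℕ} (xs : Fin s → (UnitAddTorus d)) :
    Measurable fun V : Fin s → (EuclideanSpace ℝ d) =>
      (fun i => (xs i, V i) : Config s d (UnitAddTorus d)) :=
  measurable_pi_lambda _ fun i => measurable_const.prodMk (measurable_pi_apply i)

/-- The velocity integral of the tensor power over fixed positions is at most `C^s` when the
velocity marginals of `f₀` are `≤ C`. [folklore] -/
theorem integral_tensorPow_zipVel_le (hβ : 0 < β) (hC : 0 ≤ C) (hf₀0 : 0 ≤ f₀)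
    (hf₀b : ∀ z, f₀ z ≤ C * maxwellianBeta β z.2) {s : ℕ} (xs : Fin s → (UnitAddTorus d)) :
    ∫ V : Fin s → (EuclideanSpace ℝ d), tensorPow s f₀ (fun i => (xs i, V i)) ≤ C ^ s := by
  have h : ∫ V : Fin s → (EuclideanSpace ℝ d), tensorPow s f₀ (fun i => (xs i, V i)) =
      ∏ i : Fin s, ∫ v : (EuclideanSpace ℝ d), f₀ (xs i, v) :=
    integral_fintype_prod_volume_eq_prod (fun i (v : (EuclideanSpace ℝ d)) => f₀ (xs i, v))
  rw [h]
  calc ∏ i : Fin s, ∫ v : (EuclideanSpace ℝ d), f₀ (xs i, v) ≤ ∏ _i : Fin s, C :=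
        Finset.prod_le_prod (fun i _ => integral_nonneg fun v => hf₀0 _)
          fun i _ => integral_section_le hβ hC hf₀b (xs i)
    _ = C ^ s := by simp

/-- The tensor power over fixed positions is integrable in the velocities. [folklore] -/
theorem integrable_tensorPow_zipVel (hβ : 0 < β) (hf₀m : Measurable f₀) (hf₀0 : 0 ≤ f₀)
    (hf₀b : ∀ z, f₀ z ≤ C * maxwellianBeta β z.2) {s : ℕ} (xs : Fin s → (UnitAddTorus d)) :
    Integrable fun V : Fin s → (EuclideanSpace ℝ d) => tensorPow s f₀ (fun i => (xs i, V i)) := by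
  have h1 : ∀ i : Fin s, Integrable fun v : (EuclideanSpace ℝ d) => f₀ (xs i, v) := fun i => by
    refine Integrable.mono' ((integrable_maxwellianBeta hβ).const_mul C)
      (hf₀m.comp (measurable_const.prodMk measurable_id)).aestronglyMeasurable
      (Eventually.of_forall fun v => ?_)
    rw [Real.norm_eq_abs, abs_of_nonneg (hf₀0 _)]
    exact hf₀b _
  exact Integrable.fintype_prod (f := fun i => fun v : (EuclideanSpace ℝ d) => f₀ (xs i, v)) h1

/-- **The conditioned data converge in mode A** (GST 2013 Def. 6.2.1 at the initial time,
via Prop. 6.1.2 and Lemma 6.2.2): along an exact Boltzmann–Grad sequence `N_k ε_k^{d-1} = 1`,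
`d ≥ 2`, for a datum `0 ≤ f₀ ≤ C M_β` of mass one, the (time-independent) families of marginals
of the conditioned data `𝒵_{N_k}⁻¹ 1_{D_{ε_k}^{N_k}} f₀^{⊗N_k}` converge to `(f₀^{⊗s})_s` in the
sense of `Literature.Analysis.FluidPDE.TendstoMarginals` on `[0, T]` for every `T`: for every
`s`, every `φ ∈ C_c(ℝ^{ds})` and every compact `K` off the diagonal,
`sup_{x_s ∈ K} |I_φ(f_{0,N_k}^{(s)} - f₀^{⊗s})(x_s)| ≤ ‖φ‖_∞ C^s r_k^{(s)} → 0` once `ε_k` is below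
the minimal separation on `K` (the bound `|f_{0,N}^{(s)} - f₀^{⊗s}| ≤ r_k^{(s)} f₀^{⊗s}` on
`D_{ε_k}^s` integrated against `φ`, the velocity marginals of `f₀` being `≤ C`).
[cite: GST2013, Prop. 6.1.2 and Def. 6.2.1, Lemma 6.2.2] -/
theorem tendstoMarginals_canonicalDensity (hd : 2 ≤ Fintype.card d) (hβ : 0 < β) (hC : 0 ≤ C)
    (hf₀m : Measurable f₀) (hf₀0 : 0 ≤ f₀) (hf₀b : ∀ z, f₀ z ≤ C * maxwellianBeta β z.2)
    (hf₀1 : ∫ z, f₀ z = 1) (hNε : IsBoltzmannGradSequenceExact d 1 N εk) (T : ℝ) :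
    TendstoMarginals (X := (UnitAddTorus d))
      (fun k s (_ : ℝ) => nthMarginal (N k) s (canonicalDensity (Torus.geometry d) (εk k) (N k) f₀))
      (fun s _ => tensorPow s f₀) T := by
  intro s φ hφ hφc K hK hKc
  obtain ⟨Cφ, hCφ⟩ := hφc.exists_bound_of_continuous hφ
  have hCφ0 : 0 ≤ Cφ := (norm_nonneg _).trans (hCφ 0)
  set r : ℕ → ℝ := fun k => (s + 1) * 2 ^ (s + 1) * (N k : ℝ) * ((2 * εk k) ^ Fintype.card d * C)
    with hr
  have hr0 : Tendsto r atTop (𝓝 0) := tendsto_rate_of_exact hd hNε C s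
  have hsN : ∀ᶠ k in atTop, s ≤ N k :=
    (hNε.isBoltzmannGradSequence.tendsto_atTop hd one_ne_zero).eventually_ge_atTop s
  have hsep := eventually_forall_le_euclidDist hK hKc hNε.2.1
  -- the uniform bound on `K`, eventually
  have hbound : ∀ᶠ k in atTop, ∀ xs ∈ K,
      |velocityAverage φ (nthMarginal (N k) s
          (canonicalDensity (Torus.geometry d) (εk k) (N k) f₀)) xs -
        velocityAverage φ (tensorPow s f₀) xs| ≤ Cφ * (r k * C ^ s) := by
    filter_upwards [eventually_abs_nthMarginal_canonicalDensity_sub_le hd hβ hC hf₀m hf₀0 hf₀b hf₀1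
      hNε, hsN, hsep] with k hk hks hkK xs hxs
    have hrk0 : 0 ≤ r k := by
      simp only [hr]
      exact mul_nonneg (by positivity)
        (mul_nonneg (pow_nonneg (mul_nonneg zero_le_two (hNε.1 k).le) _) hC)
    -- name the marginal and the section map (opaque names keep the unifier cheap)
    have hk1 := hk s hks
    obtain ⟨Fk, hFk⟩ : ∃ Fk : Config s d (UnitAddTorus d) → ℝ,
        Fk = nthMarginal (N k) s (canonicalDensity (Torus.geometry d) (εk k) (N k) f₀) := ⟨_, rfl⟩
    rw [← hFk] at hk1 ⊢
    obtain ⟨Z, hZ⟩ : ∃ Z : (Fin s → (EuclideanSpace ℝ d)) → Config s d (UnitAddTorus d),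
        Z = fun V i => (xs i, V i) := ⟨_, rfl⟩
    have hZD : ∀ V, Z V ∈ hardSphereDomain (Torus.geometry d) s (εk k) := by
      intro V
      rw [hZ]
      exact mem_hardSphereDomain.2 fun i j hij => by
        rw [Torus.norm_geometry_sepVec]
        exact hkK xs hxs i j hij
    have hdiff : ∀ V, |Fk (Z V) - tensorPow s f₀ (Z V)| ≤ r k * tensorPow s f₀ (Z V) := by
      intro V
      have h := (hk1 (Z V)).1
      rwa [indicator_of_mem (hZD V)] at h
    have hFle : ∀ V, |Fk (Z V)| ≤ 2 ^ s * tensorPow s f₀ (Z V) := by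
      intro V
      have h := (hk1 (Z V)).2
      rw [indicator_of_mem (hZD V)] at h
      rw [abs_of_nonneg h.1]
      exact h.2
    -- integrability
    have hBi : Integrable fun V => tensorPow s f₀ (Z V) := by
      rw [hZ]
      exact integrable_tensorPow_zipVel hβ hf₀m hf₀0 hf₀b xs
    have hFm0 : Measurable Fk := by
      rw [hFk]
      exact measurable_nthMarginal (N k) s (measurable_canonicalDensity' hf₀m)
    have hZm : Measurable Z := by
      rw [hZ]
      exact measurable_zipVel' xs
    have hFi : Integrable fun V => Fk (Z V) := by
      refine Integrable.mono' (hBi.const_mul (2 ^ s)) (hFm0.comp hZm).aestronglyMeasurable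
        (Eventually.of_forall fun V => ?_)
      rw [Real.norm_eq_abs]
      exact hFle V
    have hφm : AEStronglyMeasurable φ (volume : Measure (Fin s → (EuclideanSpace ℝ d))) :=
      hφ.measurable.aestronglyMeasurable
    have hφFi : Integrable fun V => φ V * Fk (Z V) :=
      hFi.bdd_mul hφm (Eventually.of_forall hCφ)
    have hφBi : Integrable fun V => φ V * tensorPow s f₀ (Z V) :=
      hBi.bdd_mul hφm (Eventually.of_forall hCφ)
    -- the estimate
    have hIB : ∫ V, tensorPow s f₀ (Z V) ≤ C ^ s := by
      rw [hZ]
      exact integral_tensorPow_zipVel_le hβ hC hf₀0 hf₀b xs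
    have hvF : velocityAverage φ Fk xs = ∫ V, φ V * Fk (Z V) := by
      rw [hZ]
      rfl
    have hvB : velocityAverage φ (tensorPow s f₀) xs = ∫ V, φ V * tensorPow s f₀ (Z V) := by
      rw [hZ]
      rfl
    rw [hvF, hvB, ← integral_sub hφFi hφBi]
    calc |∫ V, (φ V * Fk (Z V) - φ V * tensorPow s f₀ (Z V))|
        ≤ ∫ V, |φ V * Fk (Z V) - φ V * tensorPow s f₀ (Z V)| := abs_integral_le_integral_abs
      _ ≤ ∫ V, Cφ * (r k * tensorPow s f₀ (Z V)) := by
          refine integral_mono_of_nonneg (Eventually.of_forall fun V => abs_nonneg _)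
            ((hBi.const_mul (r k)).const_mul Cφ) (Eventually.of_forall fun V => ?_)
          dsimp only
          rw [← mul_sub, abs_mul]
          exact mul_le_mul (by simpa only [Real.norm_eq_abs] using hCφ V) (hdiff V) (abs_nonneg _)
            hCφ0
      _ = Cφ * (r k * ∫ V, tensorPow s f₀ (Z V)) := by rw [integral_const_mul, integral_const_mul]
      _ ≤ Cφ * (r k * C ^ s) :=
          mul_le_mul_of_nonneg_left (mul_le_mul_of_nonneg_left hIB hrk0) hCφ0
  -- conclusion in `ℝ≥0∞`
  rw [ENNReal.tendsto_atTop_zero]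
  intro e he
  by_cases he' : e = ⊤
  · exact ⟨0, fun k _ => he' ▸ le_top⟩
  have hδ0 : 0 < e.toReal := ENNReal.toReal_pos he.ne' he'
  have hsmall : ∀ᶠ k in atTop, Cφ * (r k * C ^ s) < e.toReal := by
    have h := (hr0.mul_const (C ^ s)).const_mul Cφ
    rw [zero_mul, mul_zero] at h
    exact h.eventually (Iio_mem_nhds hδ0)
  obtain ⟨k₀, hk₀⟩ := eventually_atTop.1 (hbound.and hsmall)
  refine ⟨k₀, fun k hk => iSup₂_le fun t _ => iSup₂_le fun xs hxs => ?_⟩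
  exact ENNReal.ofReal_le_of_le_toReal (((hk₀ k hk).1 xs hxs).trans (hk₀ k hk).2.le)

end Convergence

/-! ## The bounds in Lanford-class form (Gaussian weight in the kinetic energy) -/

section LanfordClass

variable {N : ℕ → ℕ} {εk : ℕ → ℝ}

/-- A datum `0 ≤ f₀ ≤ C M_β` is in Lanford's class with constant `C (2π/β)^{-d/2}`:
`|f₀(x, v)| ≤ C (2π/β)^{-d/2} e^{-β|v|²/2}`. [folklore] -/
theorem abs_le_mul_exp_of_le_maxwellianBeta (hf₀0 : 0 ≤ f₀)
    (hf₀b : ∀ z, f₀ z ≤ C * maxwellianBeta β z.2) (z : UnitAddTorus d × EuclideanSpace ℝ d) :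
    |f₀ z| ≤ C * (2 * Real.pi * β⁻¹) ^ (-(Module.finrank ℝ (EuclideanSpace ℝ d) : ℝ) / 2) *
      Real.exp (-(β / 2) * ‖z.2‖ ^ 2) := by
  rw [abs_of_nonneg (hf₀0 z), mul_assoc, ← maxwellianBeta_eq]
  exact hf₀b z

/-- **The uniform bound of the conditioned data in Lanford's class** (GST 2013 Prop. 6.1.2,
first step: `sup_N ‖F_{0,N}‖_{ε,β₀,μ₀'} < ∞`, here with the explicit weight): eventually along an
exact Boltzmann–Grad sequence, for all `s ≤ N_k` and all `Z_s`,
`|f_{0,N_k}^{(s)}(Z_s)| ≤ (2 C (2π/β)^{-d/2})^s e^{-β E(Z_s)}`, `E(Z_s) = ½ ∑ |v_i|²`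
(`Literature.Analysis.FluidPDE.configEnergy`) — the majorant format `M_s e^{-β E}` of the
dominated-convergence glue `tendstoMarginals_of_hasSum` (`LanfordModeAConvergence`).
[cite: GST2013, Prop. 6.1.2 (proof, first step)] -/
theorem eventually_abs_nthMarginal_canonicalDensity_le_pow_mul_exp (hd : 2 ≤ Fintype.card d)
    (hβ : 0 < β) (hC : 0 ≤ C) (hf₀m : Measurable f₀) (hf₀0 : 0 ≤ f₀)
    (hf₀b : ∀ z, f₀ z ≤ C * maxwellianBeta β z.2) (hf₀1 : ∫ z, f₀ z = 1)
    (hNε : IsBoltzmannGradSequenceExact d 1 N εk) :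
    ∀ᶠ k in atTop, ∀ s ≤ N k, ∀ Zs : Config s d (UnitAddTorus d),
      |nthMarginal (N k) s (canonicalDensity (Torus.geometry d) (εk k) (N k) f₀) Zs| ≤
        (2 * (C * (2 * Real.pi * β⁻¹) ^ (-(Module.finrank ℝ (EuclideanSpace ℝ d) : ℝ) / 2))) ^ s *
          Real.exp (-β * configEnergy Zs) := by
  filter_upwards [eventually_abs_nthMarginal_canonicalDensity_sub_le hd hβ hC hf₀m hf₀0 hf₀b hf₀1
    hNε] with k hk s hs Zs
  obtain ⟨-, h0, h2⟩ := hk s hs Zs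
  have hT0 : 0 ≤ tensorPow s f₀ Zs := tensorPow_nonneg hf₀0 s Zs
  have hT := abs_tensorPow_le_pow_mul_exp (abs_le_mul_exp_of_le_maxwellianBeta hf₀0 hf₀b) Zs
  rw [abs_of_nonneg hT0] at hT
  rw [abs_of_nonneg h0, mul_pow, mul_assoc]
  refine h2.trans (mul_le_mul_of_nonneg_left ?_ (by positivity))
  exact (indicator_le_self' (fun _ _ => hT0) Zs).trans hT

end LanfordClass

end Torus

end LanfordEmpirical

end

end Literature.MathematicalPhysics.KineticTheory
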